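import Literature.MathematicalPhysics.QuantumFieldTheory.Balaban1983to89.B9Eq328GaugeAction

/-!
# `Balaban1983to89.B9Eq330HessianCovariance` — T. Bałaban, *Propagators for lattice gauge theories in a background field*, Commun. Math. Phys.
# **99** (1985) 389–434 [Balaban1985BackgroundPropagators] (3.29)–(3.30) p. 395: THE HESSIAN `Δ^η(U) = D*D + Δ′` OF (3.10) IS GAUGE COVARIANT,
# `Δ^η(U^u) = R(u)Δ^η(U)R(u⁻¹)`, FOR THE pub-balaban NE9 CHAIN'S OPERATOR `B9Eq310HessianOperator.hessOp` — the curvature form (3.10) of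
# `B9Eq310DeltaPrime` is invariant under `(U, A, B) ↦ (U^u, R(u)A, R(u)B)` (trace cyclicity only), hence its Riesz operator `Δ′` and the Hessian
# are conjugated by `R(u)` (unitarity of `R(u(x))` on the fibre displayed)

statement-level skeleton of published theorems with citation tags; proofs where landed; nothing here is a claim about the Yang–Mills mass gap

PDF held: `paper:balaban1985-cmp99-background-propagators` (journal page = PDF page + 388), p. 395 read by this seat (2026-08-22, text layer `p0007.txt`).

THE PRINT (verbatim, p. 395).  *«Let us start with the operator Δ^η(U). It is defined by the expansion (3.12), and the gauge invariance of the
action (3.1) implies that if we make the transformations U → U^u, U′ → R(u)U′, (3.28) … then A^η(R(u)U′U^u) = A^η((U′U)^u) = A^η(U′U). (3.29) Of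
course R(u(x)) exp iηA(x,x′) = exp iηR(u(x))A(x,x′) and R(u)A is linear in A, hence expanding both sides of the above equality in A we get a
sequence of equalities between homogeneous polynomials of the same order. Taking the polynomials of first and second order we get
⟨R(u)A, J(U^u)⟩ = ⟨A, J⟩, ⟨R(u)A, Δ^η(U^u)R(u)A⟩ = ⟨A, Δ^η(U)A⟩, (3.30) or J^u = R(u)J, Δ^η(U^u) = R(u)Δ^η(U)R(u⁻¹).»*

WHY THIS FILE (cell context).  The chain's Hessian letter `Δ₁ = hessOp φ η U τ = principalOpK φ η U + curvOp φ τ η U` (`B9Eq310HessianOperator`,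
owner t4-ne9-p1 g77) is DEFINED by the printed second-order form (3.10) (`B9Eq310DeltaPrime.curvForm`), not by the expansion (3.12); so (3.30) is
proved here directly on the form: the plaquette holonomy, its complexified real/imaginary parts (built with the INVERSE `U(∂p)⁻¹`, no adjoint),
the transported edge variables `A′(b)` and the curl `(D_U A)(p)` are all CONJUGATED by `u` at the plaquette corner (`B9Eq328GaugeAction`), and the
trace datum `τ` is `Ad`-invariant.  The principal part `D*D` is covariant with no hypothesis (`B9Eq328GaugeAction.principalOpK_gaugeU`).

WHAT IS PROVED (sorry-free; 0 `def`; no inequality of the paper).  For EVERY background `U : Bond d P → 𝔸ˣ`, EVERY gauge function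
`g : TSite d P → 𝔸ˣ`, scalar `c`, `η`:
* §1 **`reHol_gaugeU`**, **`imHol_gaugeU`** (`Re/Im U^u(∂p) = R(u(x)) Re/Im U(∂p)`), **`edgeLin_gaugeU`** (the four `A′(b)`, `b ⊂ ∂(p)_z`),
  **`curlAt_gaugeU`** — no hypothesis.
* §2 **`curvForm_gaugeU`** — `⟨R(u)A, Δ′(U^u)R(u)B⟩_{(3.10)} = ⟨A, Δ′(U)B⟩_{(3.10)}` for the `τ`-bilinear curvature form, given ONLY the
  `Ad`-invariance `τ(u(x)Xu(x)⁻¹) = τ(X)` (`hτ`; trace cyclicity); `hessForm_gaugeU` likewise for the full `τ`-bilinear Hessian form of (3.7)/(3.10).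
* §3 on the weighted `L²` bond space of the chain (`B11Eq103H1Complex.BondL2K ℂ d P c₀ W`, fibre read along `φ : W ≃ₗ[ℂ] 𝔸`): `star_adCfg` (for
  UNITARY `u(x)`, `u* = u⁻¹` — needed because the sesquilinear reading `curvSesq` stars its first slot), **`curvSesq_gaugeU`**, **`curvOp_gaugeU`**
  (`Δ′(U^u)R(u) = R(u)Δ′(U)`, given `hτ`, `hstar` and the fibrewise isometry `hAd` of `R(u(x))` — the latter a theorem under the (18)-compatibility,
  `B9Eq328GaugeAction.inner_AdW_AdW_of_compat`), **`hessOp_gaugeU`** = (3.30) `Δ^η(U^u)R(u) = R(u)Δ^η(U)`, **`hessOp_gaugeU_conj`** (the printed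
  shape `Δ^η(U^u) = R(u)Δ^η(U)R(u⁻¹)` as an equality of linear maps), **`inner_hessOp_gaugeU`** (the printed quadratic-form statement
  `⟨R(u)A, Δ^η(U^u)R(u)A⟩ = ⟨A, Δ^η(U)A⟩`), `hessOp_gaugeU_isSymmetric_iff` bookkeeping omitted — symmetry is `B9Eq310HessianOperator`'s.
MODEL / DECLARED READINGS.  (M1) as `B9Eq310DeltaPrime`/`B9Eq310HessianOperator` (M1): complex-bilinear reading of (3.10) with trace datum `τ`,
fibre `W` read in `𝔸` along `φ`, uniform weight `c₀`.  (M2) DISPLAYED where used: `hτ` (`τ` is `Ad`-invariant along `u` — for print's `tr` on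
`U(N)`: cyclicity), `hstar` (`u(x)` unitary), `hAd` (`R(u(x))` isometric on `W`).  (M3) NOT HERE: `J^u = R(u)J` (the first-order term `J` of (3.12)
is not an object of the tree), (3.32)–(3.34), any bound.
HONEST SCOPE.  [folklore] finite-dimensional conjugation algebra on the cell's own typed objects realising the printed (3.30); no estimate of the
paper; NOT summit progress (cell pub-balaban: NE9 NOT PRINTED / NOT PROVED; «NE9 ⇐ the named binders»; spine PROVED 0/9; HONEST DEPENDENCY:
continuum YM on T⁴ ⇐ BetaPertH ∧ nine spine estimates (0/9 proved); BetaPertH ⇐ (D1) ∧ (D4) ∧ CAP+tail; G-an2-4 gates asym, D1 and NE2/3/4).  Unit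
`b2b-balaban-t4-ne9-formalise-leaf-03` (NE9 crux-team leaf prover, gen 60), INTENT I-ne9leaf03-g60-1 file (G1); NEW file importing
`B9Eq328GaugeAction` only; modifies nothing.  Net new unproved facts: 0.
-/

noncomputable section

open scoped InnerProductSpace ComplexConjugate BigOperators

namespace Literature.MathematicalPhysics.QuantumFieldTheory.Balaban1983to89.B9Eq330HessianCovariance

open B9SectCLatticeCarrier (Bond DirPair bpos btgt shift unshift)
open B4Sect5Torus (TSite)
open B9Eq311L2Pairing (WL2)
open B9Eq33CovDerivVector (adTransport)
open B9Eq34CovCurlVector (covCurl)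
open B9Eq310DeltaPrime (plaqHolU reHol imHol edgeLin curlAt curvBlock₁ curvBlock₂ curvForm hessForm orderedPairs edgeLin_zero edgeLin_one
  edgeLin_two edgeLin_three curlAt_apply curvBlock₁_apply curvBlock₂_apply curvForm_apply hessForm_apply)
open B11Eq103H1Complex (BondL2K)
open B9Eq310HessianOperator (adTransportW principalOpK curvSesq curvSesq_apply curvOp inner_curvOp hessOp hessOp_apply toAlg)
open B9Eq328GaugeAction

variable {d : ℕ} {Pd : Fin d → ℕ} {𝔸 : Type*} [Ring 𝔸] [Algebra ℂ 𝔸] (g : TSite d Pd → 𝔸ˣ) (U : Bond d Pd → 𝔸ˣ)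

/-! ## §1 The ingredients of (3.10) are conjugated by `u` at the plaquette corner -/

section Pieces

/-- **`Re U^u(∂p) = R(u(x)) Re U(∂p)`** (`Re U(∂p) = ½(U(∂p) + U(∂p)⁻¹)` is built with the inverse — conjugation needs no unitarity).
[cite: Balaban1985BackgroundPropagators, (3.7) p.391, (3.29) p.395] -/
theorem reHol_gaugeU (p : B9SectCLatticeCarrier.Plaq d Pd) : reHol (gaugeU g U) p = AdA (g p.1) (reHol U p) := by
  simp only [reHol, plaqHolU_gaugeU, map_smul, map_add, AdA_apply, mul_inv_rev, inv_inv, Units.val_mul, mul_assoc]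

/-- **`Im U^u(∂p) = R(u(x)) Im U(∂p)`.** [cite: Balaban1985BackgroundPropagators, (3.7) p.391, (3.29) p.395] -/
theorem imHol_gaugeU (p : B9SectCLatticeCarrier.Plaq d Pd) : imHol (gaugeU g U) p = AdA (g p.1) (imHol U p) := by
  simp only [imHol, plaqHolU_gaugeU, map_smul, map_sub, AdA_apply, mul_inv_rev, inv_inv, Units.val_mul, mul_assoc]

/-- The transporters `R(U^u(b))` of (3.4)'s curl in the algebra: `R(U^u(b)) = R(u(b₋))R(U(b))R(u(b₊))⁻¹`.
[cite: Balaban1985BackgroundPropagators, (3.28) p.395] -/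
theorem adTransport_gaugeU (b : Bond d Pd) (X : 𝔸) :
    adTransport (𝕜 := ℂ) (gaugeU g U) b X = AdA (g (bpos b)) (adTransport (𝕜 := ℂ) U b (AdA (g (btgt b))⁻¹ X)) := by
  rw [adTransport_eq_AdA, adTransport_eq_AdA, gaugeU_apply, AdA_mul_apply, AdA_mul_apply]

/-- **The four transported edge variables `A′(b)`, `b ⊂ ∂(p)_z`, are conjugated**: `A′[U^u, R(u)A](b) = R(u(x))·A′[U, A](b)` for `p = p_{μν}(x)`.
[cite: Balaban1985BackgroundPropagators, (3.2) p.390, (3.29) p.395] -/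
theorem edgeLin_gaugeU (p : B9SectCLatticeCarrier.Plaq d Pd) (k : Fin 4) (A : Bond d Pd → 𝔸) :
    edgeLin (gaugeU g U) p k (fun b => AdA (g (bpos b)) (A b)) = AdA (g p.1) (edgeLin U p k A) := by
  obtain ⟨x, q⟩ := p
  fin_cases k
  · show edgeLin (gaugeU g U) (x, q) 0 _ = AdA (g x) (edgeLin U (x, q) 0 A)
    rw [edgeLin_zero, edgeLin_zero, gaugeU_inv_apply, gaugeU_apply_dir, map_neg]
    simp only [bpos, btgt, AdA_apply, Units.val_mul, mul_assoc, Units.inv_mul_cancel_left]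
  · show edgeLin (gaugeU g U) (x, q) 1 _ = AdA (g x) (edgeLin U (x, q) 1 A)
    rw [edgeLin_one, edgeLin_one, map_neg]
  · show edgeLin (gaugeU g U) (x, q) 2 _ = AdA (g x) (edgeLin U (x, q) 2 A)
    rw [edgeLin_two, edgeLin_two]
  · show edgeLin (gaugeU g U) (x, q) 3 _ = AdA (g x) (edgeLin U (x, q) 3 A)
    rw [edgeLin_three, edgeLin_three, gaugeU_inv_apply, gaugeU_apply_dir]
    simp only [bpos, btgt, AdA_apply, Units.val_mul, mul_assoc, Units.inv_mul_cancel_left]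

/-- **The curl `(D_{U^u} R(u)A)(p) = R(u(x))(D_U A)(p)`** in the algebra (the `𝔸`-valued form of `B9Eq328GaugeAction.covCurlL2K_gaugeU`).
[cite: Balaban1985BackgroundPropagators, (3.4) p.391, (3.29) p.395] -/
theorem curlAt_gaugeU (c : ℂ) (p : B9SectCLatticeCarrier.Plaq d Pd) (A : Bond d Pd → 𝔸) :
    curlAt c (gaugeU g U) p (fun b => AdA (g (bpos b)) (A b)) = AdA (g p.1) (curlAt c U p A) := by
  rw [curlAt_apply, curlAt_apply]
  exact covCurl_conj c _ _ (fun x => AdA (g x)) (fun x => AdA (g x)⁻¹) (fun x v => AdA_inv_apply (g x) v)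
    (fun b v => adTransport_gaugeU g U b v) A p

end Pieces

/-! ## §2 The curvature form (3.10) and the Hessian form are invariant under `(U, A, B) ↦ (U^u, R(u)A, R(u)B)` -/

section Form

variable (τ : 𝔸 →ₗ[ℂ] ℂ) {g}

/-- The commutator block against a conjugated weight: `τ(([R(u)X, R(u)Y])·(s•R(u)M)) = τ([X, Y]·(s•M))` for `Ad`-invariant `τ`. [folklore]
[cite: Balaban1985BackgroundPropagators, (3.10) p.392] -/
theorem tau_comm_AdA {u : 𝔸ˣ} (hτ : ∀ X : 𝔸, τ (AdA u X) = τ X) (s : ℂ) (X Y M : 𝔸) :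
    τ ((AdA u X * AdA u Y - AdA u Y * AdA u X) * (s • AdA u M)) = τ ((X * Y - Y * X) * (s • M)) := by
  rw [← map_smul, ← AdA_map_mul, ← AdA_map_mul, ← map_sub, ← AdA_map_mul, hτ]

/-- `R(u)X − 1 = R(u)(X − 1)`. [cite: Balaban1985BackgroundPropagators, p.390] -/
theorem AdA_sub_one (u : 𝔸ˣ) (X : 𝔸) : AdA u X - 1 = AdA u (X - 1) := by
  rw [map_sub, AdA_one_right]

variable (η : ℝ)

/-- **The field-strength block of (3.10) is invariant**: `τ(½{(D R(u)A)(p), (D R(u)B)(p)}·(Re U^u(∂p) − 1)) = τ(½{(DA)(p), (DB)(p)}·(Re U(∂p) − 1))`.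
[cite: Balaban1985BackgroundPropagators, (3.10) p.392, (3.30) p.395] -/
theorem curvBlock₁_gaugeU (hτ : ∀ (x : TSite d Pd) (X : 𝔸), τ (AdA (g x) X) = τ X) (p : B9SectCLatticeCarrier.Plaq d Pd) (A B : Bond d Pd → 𝔸) :
    curvBlock₁ τ η (gaugeU g U) p (fun b => AdA (g (bpos b)) (A b)) (fun b => AdA (g (bpos b)) (B b)) = curvBlock₁ τ η U p A B := by
  rw [curvBlock₁_apply, curvBlock₁_apply, curlAt_gaugeU, curlAt_gaugeU, reHol_gaugeU, AdA_sub_one, ← AdA_map_mul, ← AdA_map_mul, ← AdA_map_mul,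
    ← AdA_map_mul, hτ, hτ]

/-- **The commutator block of (3.10) is invariant.** [cite: Balaban1985BackgroundPropagators, (3.10) p.392, (3.30) p.395] -/
theorem curvBlock₂_gaugeU (hτ : ∀ (x : TSite d Pd) (X : 𝔸), τ (AdA (g x) X) = τ X) (p : B9SectCLatticeCarrier.Plaq d Pd) (A B : Bond d Pd → 𝔸) :
    curvBlock₂ τ η (gaugeU g U) p (fun b => AdA (g (bpos b)) (A b)) (fun b => AdA (g (bpos b)) (B b)) = curvBlock₂ τ η U p A B := by
  simp only [curvBlock₂_apply, edgeLin_gaugeU, imHol_gaugeU, tau_comm_AdA τ (hτ p.1)]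

/-- **THE CURVATURE FORM (3.10) IS GAUGE INVARIANT**: `⟨R(u)A, Δ′(U^u)R(u)B⟩ = ⟨A, Δ′(U)B⟩` for the `τ`-bilinear polarized form
`B9Eq310DeltaPrime.curvForm`, given only the `Ad`-invariance of `τ` along `u`. [cite: Balaban1985BackgroundPropagators, (3.10) p.392, (3.30) p.395] -/
theorem curvForm_gaugeU (hτ : ∀ (x : TSite d Pd) (X : 𝔸), τ (AdA (g x) X) = τ X) (A B : Bond d Pd → 𝔸) :
    curvForm τ η (gaugeU g U) (fun b => AdA (g (bpos b)) (A b)) (fun b => AdA (g (bpos b)) (B b)) = curvForm τ η U A B := by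
  rw [curvForm_apply, curvForm_apply]
  exact Finset.sum_congr rfl fun p _ => by rw [curvBlock₁_gaugeU U τ η hτ, curvBlock₂_gaugeU U τ η hτ]

/-- **THE FULL HESSIAN FORM OF (3.7)/(3.10) IS GAUGE INVARIANT** (`τ`-bilinear reading `B9Eq310DeltaPrime.hessForm`): the principal block
`τ((DA)(p)(DB)(p))` is conjugated too. [cite: Balaban1985BackgroundPropagators, (3.7) p.391, (3.30) p.395] -/
theorem hessForm_gaugeU (hτ : ∀ (x : TSite d Pd) (X : 𝔸), τ (AdA (g x) X) = τ X) (A B : Bond d Pd → 𝔸) :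
    hessForm τ η (gaugeU g U) (fun b => AdA (g (bpos b)) (A b)) (fun b => AdA (g (bpos b)) (B b)) = hessForm τ η U A B := by
  rw [hessForm_apply, hessForm_apply, curvForm_gaugeU U τ η hτ]
  congr 1
  exact Finset.sum_congr rfl fun p _ => by rw [curlAt_gaugeU, curlAt_gaugeU, ← AdA_map_mul, hτ]

end Form

/-! ## §3 (3.30) for the chain's operators: `Δ′(U^u)R(u) = R(u)Δ′(U)`, `Δ^η(U^u)R(u) = R(u)Δ^η(U)` -/

section Operator

variable {W : Type*} [NormedAddCommGroup W] [InnerProductSpace ℂ W] (φ : W ≃ₗ[ℂ] 𝔸) {c₀ : ℝ} [StarRing 𝔸] [StarModule ℂ 𝔸]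
  (τ : 𝔸 →ₗ[ℂ] ℂ) (η : ℝ) {g}

omit [Algebra ℂ 𝔸] in
/-- For UNITARY `u(x)` the adjoint of a conjugated bond function is the conjugated adjoint: `(R(u)X)* = R(u)X*` pointwise.
[cite: Balaban1985BackgroundPropagators, p.391, (3.28) p.395] -/
theorem star_adCfg [Algebra ℂ 𝔸] {u : Bond d Pd → 𝔸ˣ} (hstar : ∀ b, star (u b : 𝔸) = ((u b)⁻¹ : 𝔸ˣ)) (X : Bond d Pd → 𝔸) :
    star (fun b => AdA (u b) (X b)) = fun b => AdA (u b) (star (X b)) := by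
  funext b
  rw [Pi.star_apply, star_AdA (hstar b)]

/-- **The sesquilinear reading of (3.10) on the `L²` bond space is invariant**: `curvSesq(U^u)(R(u)f, R(u)f′) = curvSesq(U)(f, f′)` (unitary
`u(x)`, `Ad`-invariant `τ`). [cite: Balaban1985BackgroundPropagators, (3.10) p.392, (3.30) p.395] -/
theorem curvSesq_gaugeU (hτ : ∀ (x : TSite d Pd) (X : 𝔸), τ (AdA (g x) X) = τ X) (hstar : ∀ x, star (g x : 𝔸) = ((g x)⁻¹ : 𝔸ˣ))
    (f f' : BondL2K ℂ d Pd c₀ W) :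
    curvSesq φ τ η (gaugeU g U) (gaugeW φ (fun b : Bond d Pd => g (bpos b)) f) (gaugeW φ (fun b : Bond d Pd => g (bpos b)) f') =
      curvSesq φ τ η U f f' := by
  rw [curvSesq_apply, curvSesq_apply, toAlg_gaugeW, toAlg_gaugeW, star_adCfg (fun b => hstar (bpos b))]
  exact curvForm_gaugeU U τ η hτ _ _

variable [FiniteDimensional ℂ W] [Fact (0 < c₀)]

/-- **`Δ′(U^u) R(u) = R(u) Δ′(U)`** for the chain's curvature OPERATOR `B9Eq310HessianOperator.curvOp` (the Riesz representative of (3.10)), given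
`hτ`, `hstar` and the fibrewise isometry `hAd` of `R(u(x))`. [cite: Balaban1985BackgroundPropagators, (3.10) p.392, (3.30) p.395] -/
theorem curvOp_gaugeU (hτ : ∀ (x : TSite d Pd) (X : 𝔸), τ (AdA (g x) X) = τ X) (hstar : ∀ x, star (g x : 𝔸) = ((g x)⁻¹ : 𝔸ˣ))
    (hAd : ∀ (x : TSite d Pd) (v v' : W), ⟪AdW φ (g x) v, AdW φ (g x) v'⟫_ℂ = ⟪v, v'⟫_ℂ) (f : BondL2K ℂ d Pd c₀ W) :
    curvOp φ τ η (gaugeU g U) (gaugeW φ (fun b : Bond d Pd => g (bpos b)) f) = gaugeW φ (fun b : Bond d Pd => g (bpos b)) (curvOp φ τ η U f) := by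
  apply ext_inner_left ℂ
  intro v
  obtain ⟨v', rfl⟩ : ∃ v', gaugeW φ (fun b : Bond d Pd => g (bpos b)) v' = v :=
    ⟨gaugeW φ (fun b : Bond d Pd => g (bpos b))⁻¹ v, gaugeW_apply_inv φ _ v⟩
  rw [inner_gaugeW φ _ (fun b => hAd (bpos b)), inner_curvOp, inner_curvOp, ← curvSesq_apply, ← curvSesq_apply, curvSesq_gaugeU U φ τ η hτ hstar]

/-- **(3.30) `Δ^η(U^u) R(u) = R(u) Δ^η(U)`** for the chain's Hessian `hessOp φ η U τ = D*D + Δ′`. [cite: Balaban1985BackgroundPropagators, (3.30) p.395] -/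
theorem hessOp_gaugeU (hτ : ∀ (x : TSite d Pd) (X : 𝔸), τ (AdA (g x) X) = τ X) (hstar : ∀ x, star (g x : 𝔸) = ((g x)⁻¹ : 𝔸ˣ))
    (hAd : ∀ (x : TSite d Pd) (v v' : W), ⟪AdW φ (g x) v, AdW φ (g x) v'⟫_ℂ = ⟪v, v'⟫_ℂ) (f : BondL2K ℂ d Pd c₀ W) :
    hessOp φ η (gaugeU g U) τ (gaugeW φ (fun b : Bond d Pd => g (bpos b)) f) = gaugeW φ (fun b : Bond d Pd => g (bpos b)) (hessOp φ η U τ f) := by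
  rw [hessOp_apply, hessOp_apply, principalOpK_gaugeU, curvOp_gaugeU U φ τ η hτ hstar hAd, map_add]

/-- **(3.30) in the printed shape `Δ^η(U^u) = R(u)Δ^η(U)R(u⁻¹)`** as an equality of linear maps of the `L²` bond space.
[cite: Balaban1985BackgroundPropagators, (3.30) p.395] -/
theorem hessOp_gaugeU_conj (hτ : ∀ (x : TSite d Pd) (X : 𝔸), τ (AdA (g x) X) = τ X) (hstar : ∀ x, star (g x : 𝔸) = ((g x)⁻¹ : 𝔸ˣ))
    (hAd : ∀ (x : TSite d Pd) (v v' : W), ⟪AdW φ (g x) v, AdW φ (g x) v'⟫_ℂ = ⟪v, v'⟫_ℂ) :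
    hessOp (c₀ := c₀) φ η (gaugeU g U) τ =
      gaugeW φ (fun b : Bond d Pd => g (bpos b)) ∘ₗ hessOp φ η U τ ∘ₗ gaugeW φ (fun b : Bond d Pd => g (bpos b))⁻¹ := by
  apply LinearMap.ext
  intro f
  rw [LinearMap.comp_apply, LinearMap.comp_apply, ← hessOp_gaugeU U φ τ η hτ hstar hAd, gaugeW_apply_inv]

/-- **(3.30), the printed quadratic-form statement: `⟨R(u)A, Δ^η(U^u)R(u)A⟩ = ⟨A, Δ^η(U)A⟩`.** [cite: Balaban1985BackgroundPropagators, (3.30) p.395] -/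
theorem inner_hessOp_gaugeU (hτ : ∀ (x : TSite d Pd) (X : 𝔸), τ (AdA (g x) X) = τ X) (hstar : ∀ x, star (g x : 𝔸) = ((g x)⁻¹ : 𝔸ˣ))
    (hAd : ∀ (x : TSite d Pd) (v v' : W), ⟪AdW φ (g x) v, AdW φ (g x) v'⟫_ℂ = ⟪v, v'⟫_ℂ) (f : BondL2K ℂ d Pd c₀ W) :
    ⟪gaugeW φ (fun b : Bond d Pd => g (bpos b)) f, hessOp φ η (gaugeU g U) τ (gaugeW φ (fun b : Bond d Pd => g (bpos b)) f)⟫_ℂ =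
      ⟪f, hessOp φ η U τ f⟫_ℂ := by
  rw [hessOp_gaugeU U φ τ η hτ hstar hAd, inner_gaugeW φ _ (fun b => hAd (bpos b))]

omit [StarRing 𝔸] [StarModule ℂ 𝔸] [FiniteDimensional ℂ W] in
/-- The principal part alone, in the printed quadratic-form shape, needs only `hAd`: `⟨R(u)A, (D*D)(U^u)R(u)A⟩ = ⟨A, (D*D)(U)A⟩`.
[cite: Balaban1985BackgroundPropagators, (3.10) p.392, (3.30) p.395] -/
theorem inner_principalOpK_gaugeU (hAd : ∀ (x : TSite d Pd) (v v' : W), ⟪AdW φ (g x) v, AdW φ (g x) v'⟫_ℂ = ⟪v, v'⟫_ℂ)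
    (f : BondL2K ℂ d Pd c₀ W) :
    ⟪gaugeW φ (fun b : Bond d Pd => g (bpos b)) f, principalOpK φ η (gaugeU g U) (gaugeW φ (fun b : Bond d Pd => g (bpos b)) f)⟫_ℂ =
      ⟪f, principalOpK φ η U f⟫_ℂ := by
  rw [principalOpK_gaugeU, inner_gaugeW φ _ (fun b => hAd (bpos b))]

end Operator

end Literature.MathematicalPhysics.QuantumFieldTheory.Balaban1983to89.B9Eq330HessianCovariance

end
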